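import Summits.ABC.ABC.Theorems.CuspFieldPencilGoldenFromNFPencil
import Summits.ABC.ABC.Theorems.YuMatveevShapeRatCloses
import Summits.ABC.ABC.Theorems.PlacewiseSzpiroSingleTowerSzpiroBakerSinglePlace
import Literature.Barriers.ABC.BakerMethodBoundsThreeRoutesProofs
import Literature.Barriers.ABC.BakerMethodBoundsStewartYuProofs
import Literature.Barriers.ABC.BakerMethodBoundsStewartTijdemanProofs
import HarnessLib

/-!
# STUB-IDEAS sketch · `stub_splitCuspTriple` · ideator k2 · GEN 4 — FAMILY 2 (RESHAPE): ONE RATIO, BOTH PLACES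

Crux `GoldenCuspShadow` (stmt-ABC-26026), route `CuspFieldPencil`, skeleton sha a4ca286a….
Elaboration-only sketch: every `sorry` is a PROPOSED HELPER LEMMA (sizes in the docstrings); the
sorry-free declarations certify that the helpers compose to the stub AND to the crux, and that the
only external input is the KERNEL THEOREM
`Summit.ABC.ABC.Theorems.approximationBound_rat_holds : ∃ K ≥ 1, PastenApproximationBound K`.

GEN-4 RESHAPE (delta over GEN 3, same seat).  GEN 3 fed two ratios to `Pasten.approx_div`
(`ξ_u = −Q/w²`: p-adic clause; `ξ_w = Q/u²`: archimedean clause) inside a regime `|w| ≤ |u|` plus a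
symmetry transport of the two-sided bound.  GEN 4 uses ONE ratio — the CUSP-0 DISTANCE FUNCTION
  `ξ₀(u,w) = −Q/w² = 1 − t(t − 11)`,  `t = u/w` the Hauptmodul of `X₁(5)`,  `1 − ξ₀ = u(u − 11w)/w²`
— and BOTH clauses of the SAME `approx_div` call (same `Θ₀ = theta K |Q| w² 0`, same
`Y = log max(e, h(ξ₀))`):
* p-adic clause at `p ∣ u` (t is p-adically close to the cusp 0): `ν_p(u) ≤ ord_p(1 − ξ₀)` ⇒
  `log|u| ≤ 3Θ₀Y · Σ_{p∣u} p`;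
* archimedean clause (t is archimedeanly close to the cusp 0, i.e. `|u| ≪ |w|`):
  `2 log|w| − log|u| − log|u − 11w| < Θ₀Y` ⇒ REGIME-FREE transfer `log H ≤ log|u| + log 12 + Θ₀Y`.
Sum: `log H ≤ log 12 + Θ₀Y(1 + 3Σ_{p∣u} p)` — the one-cusp bound `RouteU : log H ≪_ε R^ε · rad u`
with NO regime hypothesis, NO second ratio, NO `IsABCTriple`/sign-shape normalisation (k1/k3), and
the primes of `u − 11w` never enter.  The cusp ∞ is the cusp 0 of the swapped pair `(w, −u)`
(`t ↦ −1/t`): `RouteW := RouteU ∘ swap`.  `min` of the two ⇒ `CuspMinRadBound` ⇒ stub and crux.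
-/

set_option linter.dupNamespace false

noncomputable section

open Finset Real Height
open Literature.NumberTheory.DiophantineGeometry
open Literature.NumberTheory.DiophantineGeometry.Dioph
open Literature.NumberTheory.DiophantineGeometry.Pasten
open Literature.Barriers.ABC
open Summit.ABC.ABC.Theorems

namespace Summit.ABC.ABC.Cruxes.GoldenCuspShadow.SplitK2G4

/-! ## 0 · The stub (verbatim), the two one-cusp targets, the min-form, the reductions -/

/-- The registered stub signature `stub_splitCuspTriple`, verbatim. -/
def StubSplit : Prop :=
  ∀ ε : ℝ, 0 < ε → ∃ κ : ℝ, ∀ u w : ℤ, IsCoprime u w → u * w * (u ^ 2 - 11 * u * w - w ^ 2) ≠ 0 → Real.log (max (|(u : ℝ)|) (|(w : ℝ)|)) ≤ κ * (((UniqueFactorizationMonoid.radical (u * w * (u ^ 2 - 11 * u * w - w ^ 2))).natAbs : ℕ) : ℝ) ^ (ε : ℝ) * (((((UniqueFactorizationMonoid.radical u).natAbs : ℕ) : ℝ) * (((UniqueFactorizationMonoid.radical w).natAbs : ℕ) : ℝ)) ^ (2 / 3 : ℝ) * (((UniqueFactorizationMonoid.radical (u ^ 2 - 11 * u * w - w ^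 2)).natAbs : ℕ) : ℝ) ^ (1 / 3 : ℝ))

/-- ONE-CUSP TARGET at the cusp `t = 0` (`u = 0`): `log max(|u|,|w|) ≤ κ_ε · rad(uwQ)^ε · rad u`. -/
def RouteU : Prop :=
  ∀ ε : ℝ, 0 < ε → ∃ κ : ℝ, ∀ u w : ℤ, IsCoprime u w → u * w * (u ^ 2 - 11 * u * w - w ^ 2) ≠ 0 →
    Real.log (max (|(u : ℝ)|) (|(w : ℝ)|)) ≤
      κ * (((UniqueFactorizationMonoid.radical (u * w * (u ^ 2 - 11 * u * w - w ^ 2))).natAbs : ℕ) : ℝ) ^ (ε : ℝ) *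
        (((UniqueFactorizationMonoid.radical u).natAbs : ℕ) : ℝ)

/-- ONE-CUSP TARGET at the cusp `t = ∞` (`w = 0`): `log max(|u|,|w|) ≤ κ_ε · rad(uwQ)^ε · rad w`. -/
def RouteW : Prop :=
  ∀ ε : ℝ, 0 < ε → ∃ κ : ℝ, ∀ u w : ℤ, IsCoprime u w → u * w * (u ^ 2 - 11 * u * w - w ^ 2) ≠ 0 →
    Real.log (max (|(u : ℝ)|) (|(w : ℝ)|)) ≤
      κ * (((UniqueFactorizationMonoid.radical (u * w * (u ^ 2 - 11 * u * w - w ^ 2))).natAbs : ℕ) : ℝ) ^ (ε : ℝ) *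
        (((UniqueFactorizationMonoid.radical w).natAbs : ℕ) : ℝ)

/-- The min-form (same text as GEN 2/3): `log max(|u|,|w|) ≤ κ_ε · rad(uwQ)^ε · min(rad u, rad w)`. -/
def CuspMinRadBound : Prop :=
  ∀ ε : ℝ, 0 < ε → ∃ κ : ℝ, ∀ u w : ℤ, IsCoprime u w → u * w * (u ^ 2 - 11 * u * w - w ^ 2) ≠ 0 →
    Real.log (max (|(u : ℝ)|) (|(w : ℝ)|)) ≤
      κ * (((UniqueFactorizationMonoid.radical (u * w * (u ^ 2 - 11 * u * w - w ^ 2))).natAbs : ℕ) : ℝ) ^ (ε : ℝ) *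
        min ((((UniqueFactorizationMonoid.radical u).natAbs : ℕ) : ℝ))
            ((((UniqueFactorizationMonoid.radical w).natAbs : ℕ) : ℝ))

/-- R0 (XS): the two one-cusp bounds give the min-form with `κ = max (max κ_U κ_W) 0`
(`min a b = a ∨ min a b = b`; `R^ε ≥ 0`). -/
theorem cuspMinRadBound_of_routes : RouteU → RouteW → CuspMinRadBound := by
  sorry

/-- R1 (S, real arithmetic): min-form ⇒ STUB.  Radicals are `≥ 1` (`Int.radical` of a non-zero is non-zero);
`min x y ≤ (x*y)^{1/2} ≤ (x*y)^{2/3}` for `x*y ≥ 1` (`Real.rpow_le_rpow_of_exponent_le`); `1 ≤ z^{1/3}`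
(`Real.one_le_rpow`); `κ ↦ max κ 0`. -/
theorem stubSplit_of_cuspMinRadBound : CuspMinRadBound → StubSplit := by
  sorry

/-- R2 (S): min-form ⇒ CRUX: `min(rad u, rad w) ≤ (rad u · rad w)^{1/2} ≤ R^{1/2}` by
`GoldenFromNFPencil.natAbs_radical_prod` (`R = rad u · rad w · rad Q`, each `≥ 1`); `R^ε · R^{1/2} = R^{1/2+ε}`
(`Real.rpow_add`). -/
theorem goldenCuspShadow_of_cuspMinRadBound :
    CuspMinRadBound → Summit.ABC.ABC.Theses.CuspFieldPencil.GoldenCuspShadow := by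
  sorry

/-! ## 1 · Objects (abbreviations only; no new notions) -/

/-- `Q(u,w) = u² − 11uw − w²` (norm form of the two irrational cusps of `X₁(5)`). -/
abbrev Q (u w : ℤ) : ℤ := u ^ 2 - 11 * u * w - w ^ 2

/-- `H(u,w) = max(|u|,|w|)` as a real number. -/
abbrev H (u w : ℤ) : ℝ := max |(u : ℝ)| |(w : ℝ)|

/-- `sign z` as a rational number. -/
abbrev sgn (z : ℤ) : ℚ := ((Int.sign z : ℤ) : ℚ)

/-- THE ONE RATIO: `ξ₀ = −Q/w²` in the `approx_div` shape `ζ · (x : ℚ)/y`, `x = |Q|`, `y = |w|²`, `ζ = −sign Q`. -/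
abbrev xiU (u w : ℤ) : ℚ := (-sgn (Q u w)) * ((((Q u w).natAbs : ℕ) : ℚ) / ((w.natAbs ^ 2 : ℕ) : ℚ))

/-- `Θ₀ = theta K |Q| |w|² 0` — Pasten's `Θ` of the one ratio (only the primes of `Q` and `w`). -/
abbrev Th (K : ℝ) (u w : ℤ) : ℝ := theta K (Q u w).natAbs (w.natAbs ^ 2) 0

/-- `Y = log max(e, h(ξ₀))` — the common log-log factor of BOTH clauses of the one call. -/
abbrev Yxi (u w : ℤ) : ℝ := Real.log (max (Real.exp 1) (logHeight₁ (xiU u w)))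

/-! ## 2 · Algebra (XS, proved here) -/

/-- `T₀ : w² + Q = u(u − 11w)`, i.e. `1 − ξ₀ = u(u−11w)/w² = t(t−11)`. -/
theorem tU (u w : ℤ) : w ^ 2 + Q u w = u * (u - 11 * w) := by
  simp only [Q]; ring

/-- The cusp swap `(u, w) ↦ (w, −u)` (`t ↦ −1/t`) negates `Q` … -/
theorem Q_swap (u w : ℤ) : Q w (-u) = -Q u w := by
  simp only [Q]; ring

/-- … and FIXES the product `u·w·Q` literally (so `rad(uwQ)` is unchanged). -/
theorem prod_swap (u w : ℤ) : w * (-u) * Q w (-u) = u * w * Q u w := by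
  simp only [Q]; ring

/-- H0 (XS, cast bookkeeping): `(radical z).natAbs`, as a real, is the product of the rational primes of `z`. -/
theorem natAbs_radical_cast (z : ℤ) :
    (((UniqueFactorizationMonoid.radical z).natAbs : ℕ) : ℝ) = ∏ p ∈ z.natAbs.primeFactors, (p : ℝ) := by
  rw [← Int.radical_natAbs_eq_radical, Int.natAbs_natCast, Nat.radical_eq_prod_primeFactors, Nat.cast_prod]

/-! ## 3 · Side conditions of the ONE `approx_div` call (XS–S) -/

/-- A1 (XS): `ζ = −sign Q = ±1` for `Q ≠ 0` (`Int.sign_eq_one_of_pos`, `Int.sign_eq_neg_one_of_neg`). -/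
theorem neg_sgn_cases {z : ℤ} (hz : z ≠ 0) : (-sgn z = 1 ∨ -sgn z = -1) := by
  sorry

/-- A2 (XS): `1 − ξ₀ = u(u − 11w)/w²` (`Int.sign_mul_natAbs`, `Int.natCast_natAbs`, `sq_abs`, `tU`). -/
theorem one_sub_xiU {u w : ℤ} (hw : w ≠ 0) :
    1 - xiU u w = ((u : ℚ) * (u - 11 * w)) / (w : ℚ) ^ 2 := by
  sorry

/-- E1 (XS): the cusp-0 escape `u = 11w` forces `(u, w) = ±(11, 1)` (`w` is a unit), so `H = 11`. -/
theorem escape_u {u w : ℤ} (h : IsCoprime u w) (he : u - 11 * w = 0) : H u w = 11 := by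
  sorry

/-- E3 (S−): `x·y > 1`: `|Q|·w² = 1` would force `u(u − 11w) = w² + Q ∈ {0, 2}` — `0` is the escape, `2` has no
solution with `w = ±1` (`u ∣ 2`, four cases). -/
theorem one_lt_xy_u {u w : ℤ} (h : IsCoprime u w) (h0 : u * w * Q u w ≠ 0) (hne : u - 11 * w ≠ 0) :
    1 < (Q u w).natAbs * w.natAbs ^ 2 := by
  sorry

/-- E5 (XS): `gcd(|Q|, |w|²) = 1` (`GoldenFromNFPencil.isCoprime_quadForm_right`, `Int.isCoprime_iff_gcd_eq_one`,
`Nat.Coprime.pow_right`). -/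
theorem coprime_xy_u {u w : ℤ} (h : IsCoprime u w) : ((Q u w).natAbs).Coprime (w.natAbs ^ 2) := by
  sorry

/-- E6 (XS): `ξ₀ ≠ 1` off the escape (by A2: `1 − ξ₀ = u(u−11w)/w² ≠ 0`). -/
theorem xiU_ne_one {u w : ℤ} (h0 : u * w * Q u w ≠ 0) (hne : u - 11 * w ≠ 0) : xiU u w ≠ 1 := by
  sorry

/-! ## 4 · The ONE call `approx_div hK hP (x := |Q|) (y := |w|²) (N := 0) (ζ := −sign Q)`, BOTH clauses -/

/-- C0 (PROVED — the ONE CALL, packaged with its side conditions A1/E3/E5/E6): both clauses of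
`Pasten.approx_div` for `ξ₀`, with `Θ₀ = Th K u w`; this is the exact term the prover uses in C1 and C2. -/
theorem cusp0_call {K : ℝ} (hK : 1 ≤ K) (hP : PastenApproximationBound K) {u w : ℤ}
    (h : IsCoprime u w) (h0 : u * w * Q u w ≠ 0) (hne : u - 11 * w ≠ 0) :
    (-Real.log |((1 - xiU u w : ℚ) : ℝ)| < Th K u w * Yxi u w) ∧
    ∀ p : ℕ, p.Prime → (padicValRat p (1 - xiU u w) : ℝ) * Real.log p <
        Th K u w * ((p / Real.log p) * Real.log (max (Real.exp 1) (p * logHeight₁ (xiU u w)))) := by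
  obtain ⟨huw, hQ⟩ := mul_ne_zero_iff.mp h0
  obtain ⟨_, hw⟩ := mul_ne_zero_iff.mp huw
  have hx : (Q u w).natAbs ≠ 0 := Int.natAbs_ne_zero.mpr hQ
  have hy : w.natAbs ^ 2 ≠ 0 := pow_ne_zero _ (Int.natAbs_ne_zero.mpr hw)
  exact approx_div hK hP hx hy (coprime_xy_u h) (one_lt_xy_u h h0 hne) 0 (neg_sgn_cases hQ)
    (xiU_ne_one h0 hne)

/-- P1 (S): for `p ∣ u`: `ν_p(u) ≤ ν_p(u) + ν_p(u − 11w) = ord_p(1 − ξ₀)` (`p ∤ w` by coprimality;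
`padicValRat.div`, `padicValRat.mul`, `padicValRat.of_int`, `Nat.factorization_def`). -/
theorem factorization_le_padicValRat_xiU {u w : ℤ} (h : IsCoprime u w) (h0 : u * w * Q u w ≠ 0)
    (hne : u - 11 * w ≠ 0) {p : ℕ} (hp : p ∈ u.natAbs.primeFactors) :
    ((u.natAbs.factorization p : ℕ) : ℝ) ≤ ((padicValRat p (1 - xiU u w) : ℤ) : ℝ) := by
  sorry

/-- P2 (S, generic bookkeeping = the summation inside `ThreeRoutes.log_lt_route_a`):
`log|u| = ∑_{p∣u} ν_p(u) log p` (`log_eq_sum_factorization_mul_log`) against a prime-by-prime bound. -/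
theorem log_natAbs_le_of_padic {u : ℤ} (hu : u ≠ 0) {ξ : ℚ} {Θ : ℝ} {F : ℕ → ℝ}
    (hval : ∀ p ∈ u.natAbs.primeFactors, ((u.natAbs.factorization p : ℕ) : ℝ) ≤ ((padicValRat p (1 - ξ) : ℤ) : ℝ))
    (hbd : ∀ p : ℕ, p.Prime → ((padicValRat p (1 - ξ) : ℤ) : ℝ) * Real.log p < Θ * F p) :
    Real.log |(u : ℝ)| ≤ Θ * ∑ p ∈ u.natAbs.primeFactors, F p := by
  sorry

/-- P3 (S, numerics at one prime): `max(e, p·h) ≤ p · max(e, h)` (`p ≥ 2`, `h ≥ 0`), then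
`ThreeRoutes.div_log_mul_add_le` (`(p/log p)(log p + Y) ≤ 3pY`, `Y = log max(e,h) ≥ 1`). -/
theorem numerics_prime {p : ℕ} (hp : p.Prime) {h : ℝ} (hh : 0 ≤ h) :
    (p : ℝ) / Real.log p * Real.log (max (Real.exp 1) (p * h)) ≤
      3 * p * Real.log (max (Real.exp 1) h) := by
  sorry

/-- C1 (M−, p-adic clause summed over `p ∣ u`): `log|u| ≤ 3 · Θ₀ · Y · Σ_{p ∣ u} p`
(`(approx_div hK hP _ _ (coprime_xy_u h) (one_lt_xy_u …) 0 (neg_sgn_cases _) (xiU_ne_one …)).2` + P1 + P2 + P3,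
`theta_nonneg`).  The primes of `u − 11w` never enter. -/
theorem cusp0_padic {K : ℝ} (hK : 1 ≤ K) (hP : PastenApproximationBound K) {u w : ℤ}
    (h : IsCoprime u w) (h0 : u * w * Q u w ≠ 0) (hne : u - 11 * w ≠ 0) :
    Real.log |(u : ℝ)| ≤ 3 * Th K u w * Yxi u w * ∑ p ∈ u.natAbs.primeFactors, (p : ℝ) := by
  sorry

/-- C2 (S, archimedean clause of the SAME call): `−log|1 − ξ₀| = 2 log|w| − log|u| − log|u − 11w| < Θ₀ · Y`
(`(approx_div …).1` + A2, `Rat.cast_div/mul/pow`, `Real.log_div/mul/pow`, `abs` bookkeeping). -/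
theorem cusp0_arch {K : ℝ} (hK : 1 ≤ K) (hP : PastenApproximationBound K) {u w : ℤ}
    (h : IsCoprime u w) (h0 : u * w * Q u w ≠ 0) (hne : u - 11 * w ≠ 0) :
    2 * Real.log |(w : ℝ)| - Real.log |(u : ℝ)| - Real.log |((u - 11 * w : ℤ) : ℝ)| <
      Th K u w * Yxi u w := by
  sorry

/-- C3 (S, the REGIME-FREE transfer): `log H ≤ log|u| + log 12 + Θ₀ · Y`.
Case `|w| ≤ |u|`: `H = |u|` and `log 12 + Θ₀Y ≥ 0` (`theta_nonneg`, `Y ≥ 1`).  Case `|u| < |w|`: `H = |w|`,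
`|u − 11w| ≤ 12|w|` so C2 gives `log|w| < log|u| + log 12 + Θ₀Y`. -/
theorem cusp0_transfer {K : ℝ} (hK : 1 ≤ K) (hP : PastenApproximationBound K) {u w : ℤ}
    (h : IsCoprime u w) (h0 : u * w * Q u w ≠ 0) (hne : u - 11 * w ≠ 0) :
    Real.log (H u w) ≤ Real.log |(u : ℝ)| + Real.log 12 + Th K u w * Yxi u w := by
  sorry

/-- C4 (proved, composition of C1 and C3): the one-cusp pre-bound before absorption. -/
theorem cusp0_pre {K : ℝ} (hK : 1 ≤ K) (hP : PastenApproximationBound K) {u w : ℤ}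
    (h : IsCoprime u w) (h0 : u * w * Q u w ≠ 0) (hne : u - 11 * w ≠ 0) :
    Real.log (H u w) ≤
      Real.log 12 + Th K u w * Yxi u w * (1 + 3 * ∑ p ∈ u.natAbs.primeFactors, (p : ℝ)) := by
  have h1 := cusp0_padic hK hP h h0 hne
  have h2 := cusp0_transfer hK hP h h0 hne
  have h3 : Th K u w * Yxi u w * (1 + 3 * ∑ p ∈ u.natAbs.primeFactors, (p : ℝ)) =
      Th K u w * Yxi u w + 3 * Th K u w * Yxi u w * ∑ p ∈ u.natAbs.primeFactors, (p : ℝ) := by ring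
  linarith

/-! ## 5 · Absorption: heights, `Θ₀ ≪ R^η`, `Σ p ≤ rad` -/

/-- Y1 (S): `h(ξ₀) ≤ log(13·H⁴)` (`Pasten.logHeight₁_sign_mul_div_le`: `h(±x/y) ≤ log x + log y`; `|Q| ≤ 13H²`, `w² ≤ H²`). -/
theorem logHeight₁_xiU_le {u w : ℤ} (h0 : u * w * Q u w ≠ 0) :
    logHeight₁ (xiU u w) ≤ Real.log (13 * H u w ^ 4) := by
  sorry

/-- Y2 (S, numerics: at `2 log H ≤ e` LHS `≤ log 8.01 < 3`; beyond, `log 13 + 2(2y) ≤ (2y)³` for `2y ≥ e`):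
`log max(e, h) ≤ 3 · log max(e, 2 log H)` whenever `h ≤ log(13 H⁴)`, `H ≥ 1`. -/
theorem logmax_le_three {Hr h : ℝ} (hH : 1 ≤ Hr) (hh : h ≤ Real.log (13 * Hr ^ 4)) :
    Real.log (max (Real.exp 1) h) ≤ 3 * Real.log (max (Real.exp 1) (2 * Real.log Hr)) := by
  sorry

/-- T0 (S, radical bookkeeping): `rad(|Q|, |w|², |u|) = rad(u·w·Q)` as natural numbers
(`Nat.primeFactors_mul`, `Nat.primeFactors_pow`, `Int.natAbs_mul`, `Nat.radical_eq_prod_primeFactors`). -/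
theorem rad_aux_eq {u w : ℤ} (h0 : u * w * Q u w ≠ 0) :
    rad (Q u w).natAbs (w.natAbs ^ 2) u.natAbs = (UniqueFactorizationMonoid.radical (u * w * Q u w)).natAbs := by
  sorry

/-- T1 (XS after T0): `Θ₀ ≤ K · C · R^η` — ONE tree call:
`SingleTowerSzpiroLine.theta_zero_le_mul_rpow hK hη hC _ _ (coprime_xy_u h) (dvd_mul_right _ _) _` with
`(u, v, a, b, c) := (|Q|, |w|², |Q|, |w|², |u|)`, then `rad_aux_eq`. -/
theorem theta_cusp0_le {K C η : ℝ} (hK : 1 ≤ K) (hη : 0 ≤ η)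
    (hC : ∀ S : Finset ℕ, (∀ p ∈ S, p.Prime) → ∏ p ∈ S, K * Real.log p / (p : ℝ) ^ η ≤ C)
    {u w : ℤ} (h : IsCoprime u w) (h0 : u * w * Q u w ≠ 0) :
    Th K u w ≤ K * C * (((UniqueFactorizationMonoid.radical (u * w * Q u w)).natAbs : ℕ) : ℝ) ^ η := by
  sorry

/-- J3 (XS): `1 + 3 Σ_{p ∣ u} p ≤ 4 · rad u` (`StewartTijdeman.sum_le_prod_of_two_le`, H0, `rad u ≥ 1`). -/
theorem one_add_three_sum_le {u : ℤ} (hu : u ≠ 0) :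
    1 + 3 * ∑ p ∈ u.natAbs.primeFactors, (p : ℝ) ≤ 4 * (((UniqueFactorizationMonoid.radical u).natAbs : ℕ) : ℝ) := by
  sorry

/-! ## 6 · Endgame: the one-cusp bound, self-improvement, the cusp swap -/

/-- G1 (M−, the heart, ~60 lines): for every `η > 0` there is `A ≥ 1` with
`log H ≤ A · R^η · rad u · log max(e, 2 log H)` for ALL coprime `(u, w)` with `uwQ ≠ 0` (no regime hypothesis).
Proof: `⟨C, hC1, hC⟩ := SingleTowerSzpiroLine.exists_prod_mul_log_div_rpow_le (A := K) hK0 hη`; escape `u = 11w`: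
`H = 11` (E1), every factor on the right is `≥ 1`, `A ≥ log 11`; else C4 + Y1/Y2 (`Y ≤ 3 log max(e, 2 log H)`) +
T1 + J3: `Θ₀·Y·(1+3Σp) ≤ (K·C·R^η)·(3L)·(4 rad u)`, so `A := log 12 + 12·K·C` works (any larger constant too). -/
theorem preRouteU {K : ℝ} (hK : 1 ≤ K) (hP : PastenApproximationBound K) {η : ℝ} (hη : 0 < η) :
    ∃ A : ℝ, 1 ≤ A ∧ ∀ u w : ℤ, IsCoprime u w → u * w * Q u w ≠ 0 →
      Real.log (H u w) ≤
        A * (((UniqueFactorizationMonoid.radical (u * w * Q u w)).natAbs : ℕ) : ℝ) ^ η *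
          (((UniqueFactorizationMonoid.radical u).natAbs : ℕ) : ℝ) *
          Real.log (max (Real.exp 1) (2 * Real.log (H u w))) := by
  sorry

/-- G2 (S, self-improvement + exponent bookkeeping): with `η = min(ε,1)/3`, `m = rad u`, `M = A R^η m ≥ 1`:
`StewartYu.le_of_le_mul_log_max` gives `log H ≤ 2M log(4M)`; `log(4M) ≤ (4M)^η/η` (`Real.log_le_rpow_div`);
`m^η ≤ R^η` (`m ≤ R` by `GoldenFromNFPencil.natAbs_radical_prod`); `2η + η² ≤ 3η ≤ ε` and `R ≥ 1`
(`Real.rpow_le_rpow_of_exponent_le`); `κ := (2/η) · 4^η · A^{1+η}`. -/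
theorem routeU_of_pre
    (hpre : ∀ η : ℝ, 0 < η → ∃ A : ℝ, 1 ≤ A ∧ ∀ u w : ℤ, IsCoprime u w → u * w * Q u w ≠ 0 →
      Real.log (H u w) ≤
        A * (((UniqueFactorizationMonoid.radical (u * w * Q u w)).natAbs : ℕ) : ℝ) ^ η *
          (((UniqueFactorizationMonoid.radical u).natAbs : ℕ) : ℝ) *
          Real.log (max (Real.exp 1) (2 * Real.log (H u w)))) :
    RouteU := by
  sorry

/-- G3 (XS–S, the cusp swap `t ↦ −1/t`): `RouteU → RouteW` by applying `RouteU` to `(w, −u)`: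
`IsCoprime.neg_right`, `prod_swap` (same product, same radical), `abs_neg` + `max_comm` (same `H`),
`Int.radical` of `−u` vs `u` (`Int.radical_natAbs_eq_radical` / `Associated.neg_left`). -/
theorem routeW_of_routeU : RouteU → RouteW := by
  sorry

/-! ## 7 · Assembly (sorry-free): helpers ⇒ one-cusp bounds ⇒ min-form ⇒ stub and crux, UNCONDITIONALLY -/

/-- The cusp-0 bound from any `K ≥ 1` with `PastenApproximationBound K`. -/
theorem routeU_of_pasten {K : ℝ} (hK : 1 ≤ K) (hP : PastenApproximationBound K) : RouteU :=
  routeU_of_pre fun _ hη => preRouteU hK hP hη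

/-- `RouteU` holds outright: the input `∃ K ≥ 1, PastenApproximationBound K` is the kernel theorem
`approximationBound_rat_holds` (route YuMatveevShapeRat, closed·proved). -/
theorem routeU_holds : RouteU := by
  obtain ⟨K, hK, hP⟩ := approximationBound_rat_holds
  exact routeU_of_pasten hK hP

/-- `RouteW` by the cusp swap. -/
theorem routeW_holds : RouteW :=
  routeW_of_routeU routeU_holds

/-- The min-form. -/
theorem cuspMinRadBound_holds : CuspMinRadBound :=
  cuspMinRadBound_of_routes routeU_holds routeW_holds

/-- THE STUB, modulo the sorried helpers only. -/
theorem stubSplit_holds : StubSplit :=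
  stubSplit_of_cuspMinRadBound cuspMinRadBound_holds

/-- THE CRUX `GoldenCuspShadow` by name, modulo the sorried helpers only. -/
theorem goldenCuspShadow_holds : Summit.ABC.ABC.Theses.CuspFieldPencil.GoldenCuspShadow :=
  goldenCuspShadow_of_cuspMinRadBound cuspMinRadBound_holds

/-! ## 8 · Unit tests of the side conditions at the extremal / degenerate pairs (kernel-checked) -/

/-- The escape pair `(11, 1)`: `u − 11w = 0`, `Q = −1`, and `|Q|·w² = 1` (so `approx_div` is NOT called there). -/
example : Q 11 1 = -1 ∧ (11 : ℤ) - 11 * 1 = 0 := by decide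

/-- Off the escape `x·y = |Q|·w² > 1` already at the smallest pairs: `(1,1)`: `Q = −11`; `(1,−1)`: `Q = 11`;
`(2,1)`: `Q = −19`; `(12,1)`: `Q = 11`. -/
example : Q 1 1 = -11 ∧ Q 1 (-1) = 11 ∧ Q 2 1 = -19 ∧ Q 12 1 = 11 := by decide

/-- The swap really is `t ↦ −1/t` on the level of `Q`: `Q(1, −11) = −Q(11, 1)`… and `(1, −11)` is the cusp-∞ escape. -/
example : Q 1 (-11) = -Q 11 1 ∧ (1 : ℤ) - 11 * (-11) ≠ 0 ∧ (-11 : ℤ) - 11 * (-1) = 0 := by decide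

end Summit.ABC.ABC.Cruxes.GoldenCuspShadow.SplitK2G4

end
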